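import Summits.ResolutionOfSingularities.ResolutionOfSingularities.Theorems.PurelyInseparableDim4InScopeWinCertLeaves
import Summits.ResolutionOfSingularities.ResolutionOfSingularities.Theorems.PurelyInseparableDim4FlatAbsorbPrep
import HarnessLib

/-!
# In-scope win certificates with F-KEYED child look-up (`iwinCertBLF`): the books `r`, `exc` are not read
# (cell `res-dim4-pi`; F4-C instrument ‖ K, 𝔽₂ column; seat res-dim4-p-13 (g2))

[OURS · counted 0 · certificate format for OUR frame v4, not about resolution] Nothing here is a statement about
resolution of singularities; resolution in dimension `≥ 4` / characteristic `p > 0` is NOT proved by anything here.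

res-dim4-p-14's `iwinCertB` / `iwinCertBL` (`…InScopeWinCert`, `…InScopeWinCertLeaves`) look a child state up among
the later rows / the leaves by the FULL presented state `(F, r, exc)` (`SData.equivB`).  The game value does not read
the books: `FlatAbsorb.inScopeStateWins_congr` (res-rescue-typ-3 g8, `…FlatAbsorbPrep`) — legality, equimultiplicity
and the child polynomial depend on `F` alone.  So a certificate may CITE a row or leaf with the same `F` and different
`r`, `exc`: along-centre translations and different histories produce the same `F` many times (the band-closure tree of
S1a-a6cadc9aff had 223 states for ≈ 90 polynomials).  This file is the F-keyed variant, otherwise verbatim: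

* `ichildInF` (child matched on the term list `L` only: `StepKit.equivB c.L r.1.L`), `ireplyOKF`, `irowOKF`,
  **`iwinCertBLF q L T`** (rows checked against the later rows and the leaf states `L`, both F-keyed);
* soundness **`inScopeStateWins_of_iwinCertBLF`**: `(∀ s ∈ L, InScopeStateWins q s.toState) → iwinCertBLF q L T = true →
  ∀ row ∈ T, InScopeStateWins q row.1.toState` — p-14's induction with `inScopeStateWins_congr` at the citation;
  `inScopeStateWins_of_all_iwinCertBLF`, `iwinCertBLF_of_iwinCertBL` (every `iwinCertBL` certificate passes);
* acceptance (`decide`, `𝔽₂`): p-14's SCOPE-LOSS root with ONE leaf for its four blind children's two polynomials… — here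
  the minimal example: the root `x₁³x₂ + x₁³x₃x₄` certified against the scope-loss leaves with their `exc` books ERASED
  (`iwinCertBLF_scopeLossRootF`; the resulting `InScopeStateWins` statement is p-14's landed
  `inScopeStateWins_scopeLossRoot'`, not restated).

CAVEAT as for every `𝔽₂` certificate: `K`-rational replies over the finite `K` only.  OURS; counted 0; AI kernel work,
weaker than expert review.  bears_on: LADDER-RESOLUTION:D157-DOOR2 (res-dim4-pi · F4-C instrument ‖ K).
Supports stmt-ResolutionOfSingularities-16155 (helper).
-/

set_option linter.dupNamespace false -- mandated namespace of this single-conjunct summit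

noncomputable section

namespace Summit.ResolutionOfSingularities.ResolutionOfSingularities.Theorems.PIDim4

namespace InScopeWinCert

open Literature.AlgebraicGeometry.Resolution
open StepKit WinCertSound ScopeBlind

variable {K : Type} [Field K] [DecidableEq K] [Fintype K]

/-! ## 1. The F-keyed checker -/

/-- **F-keyed child look-up**: the child's POLYNOMIAL occurs among the states of `rest` (books ignored). [folklore] -/
def ichildInF (rest : ICert K) (c : SData 4 K) : Bool :=
  rest.any fun r => StepKit.equivB c.L r.1.L

/-- B's reply `(j, b)` is harmless: not equimultiple, or kills `F`, or its polynomial is certified later. [folklore] -/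
def ireplyOKF (q : ℕ) (rest : ICert K) (s : SData 4 K) (S : Finset (Fin 4)) (j : Fin 4) (b : Fin 4 → K) : Bool :=
  !(equiB q S j b s) || StepKit.equivB (stepD q S j b s).L [] || ichildInF rest (stepD q S j b s)

/-- The F-keyed row check (blind, or origin not `q`-fold, or a permissible centre all of whose `K`-replies are
harmless). [folklore] -/
def irowOKF (q : ℕ) (rest : ICert K) (row : IRow K) : Bool :=
  blindOK q row || !(permB q Finset.univ row.1.L) ||
    (permB q row.2.1 row.1.L &&
      decide (∀ j ∈ row.2.1, ∀ b : Fin 4 → K, b j = 0 → ireplyOKF q rest row.1 row.2.1 j b = true))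

/-- **The F-keyed in-scope win-certificate checker with external leaves.** [folklore] -/
def iwinCertBLF (q : ℕ) (L : List (SData 4 K)) : ICert K → Bool
  | [] => true
  | row :: rest => irowOKF q (rest ++ leafRows L) row && iwinCertBLF q L rest

omit [Fintype K] in
/-- Soundness of `ichildInF`: a cited row has the same polynomial. [folklore] -/
theorem exists_of_ichildInF [Fintype K] {rest : ICert K} {c : SData 4 K} (h : ichildInF rest c = true) :
    ∃ r ∈ rest, c.toState.F = r.1.toState.F := by
  unfold ichildInF at h
  obtain ⟨r, hr, hrc⟩ := List.any_eq_true.mp h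
  exact ⟨r, hr, by rw [SData.toState_F, SData.toState_F]; exact (evalT_eq_iff_equivB _ _).mpr hrc⟩

/-- **SOUNDNESS of one F-keyed row.** [folklore] -/
theorem inScopeStateWins_of_irowOKF {q : ℕ} {rest : ICert K}
    (hrest : ∀ r ∈ rest, InScopeStateWins q r.1.toState) {row : IRow K}
    (h : irowOKF q rest row = true) : InScopeStateWins q row.1.toState := by
  unfold irowOKF at h
  rw [Bool.or_eq_true, Bool.or_eq_true] at h
  rcases h with (hblind | hterm) | hmove
  · unfold blindOK at hblind
    obtain ⟨s, S, oβ⟩ := row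
    cases oβ with
    | none => exact absurd hblind Bool.false_ne_true
    | some β => exact inScopeStateWins_of_not_inCoordinateScope (not_inCoordinateScope_of_check hblind)
  · have hperm : permB q Finset.univ row.1.L = false := by
      rw [Bool.not_eq_true'] at hterm; exact hterm
    exact inScopeStateWins_of_no_permissible (no_permissible_of_not_permB hperm)
  · rw [Bool.and_eq_true, decide_eq_true_eq] at hmove
    obtain ⟨hS, hall⟩ := hmove
    refine inScopeStateWins_move row.2.1 ((isPermissibleCentre_iff q row.2.1 row.1.L).mpr hS) ?_
    rintro s' ⟨j, b, hj, hbj, heq, hne, rfl⟩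
    have h := hall j hj b hbj
    unfold ireplyOKF at h
    rw [Bool.or_eq_true, Bool.or_eq_true] at h
    rcases h with (h1 | h2) | h3
    · rw [Bool.not_eq_true', ← Bool.not_eq_true] at h1
      exact absurd ((isEquimultiplePoint_iff q row.2.1 j b row.1).mp heq) h1
    · exact absurd h2
        (by rw [Bool.not_eq_true]; exact (step_F_ne_zero_iff q row.2.1 j b row.1).mp hne)
    · obtain ⟨r, hr, hrc⟩ := exists_of_ichildInF h3
      refine FlatAbsorb.inScopeStateWins_congr (hrest r hr) _ ?_
      rw [← hrc, step_toState]

/-- **SOUNDNESS OF F-KEYED IN-SCOPE WIN CERTIFICATES WITH EXTERNAL LEAVES.** [folklore] -/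
theorem inScopeStateWins_of_iwinCertBLF {q : ℕ} {L : List (SData 4 K)}
    (hL : ∀ s ∈ L, InScopeStateWins q s.toState) :
    ∀ {T : ICert K}, iwinCertBLF q L T = true → ∀ row ∈ T, InScopeStateWins q row.1.toState
  | [], _ => fun row hrow => absurd hrow List.not_mem_nil
  | row :: rest, h => by
    unfold iwinCertBLF at h
    rw [Bool.and_eq_true] at h
    have hrest := inScopeStateWins_of_iwinCertBLF hL h.2
    have hrestL : ∀ r ∈ rest ++ leafRows L, InScopeStateWins q r.1.toState := by
      intro r hr
      rcases List.mem_append.mp hr with h1 | h2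
      · exact hrest r h1
      · obtain ⟨s, hs, rfl⟩ := mem_leafRows h2
        exact hL s hs
    intro r hr
    rcases List.mem_cons.mp hr with rfl | hr'
    · exact inScopeStateWins_of_irowOKF hrestL h.1
    · exact hrest r hr'

/-- The ROOT of a checked F-keyed certificate is in-scope escapable. [folklore] -/
theorem inScopeStateWins_head_of_iwinCertBLF {q : ℕ} {L : List (SData 4 K)}
    (hL : ∀ s ∈ L, InScopeStateWins q s.toState) {row : IRow K} {rest : ICert K}
    (h : iwinCertBLF q L (row :: rest) = true) : InScopeStateWins q row.1.toState :=
  inScopeStateWins_of_iwinCertBLF hL h row List.mem_cons_self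

/-- **Batch form.** [folklore] -/
theorem inScopeStateWins_of_all_iwinCertBLF {q : ℕ} {L : List (SData 4 K)}
    (hL : ∀ s ∈ L, InScopeStateWins q s.toState) {Ts : List (ICert K)}
    (h : Ts.all (iwinCertBLF q L) = true) : ∀ T ∈ Ts, ∀ row ∈ T, InScopeStateWins q row.1.toState :=
  fun T hT => inScopeStateWins_of_iwinCertBLF hL (List.all_eq_true.mp h T hT)

/-! ## 2. Every `iwinCertBL` certificate passes the F-keyed check -/

omit [Fintype K] in
/-- Full-state look-up implies F-keyed look-up. [folklore] -/
theorem ichildInF_of_ichildIn [Fintype K] {rest : ICert K} {c : SData 4 K} (h : ichildIn rest c = true) :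
    ichildInF rest c = true := by
  unfold ichildIn at h
  unfold ichildInF
  obtain ⟨r, hr, hrc⟩ := List.any_eq_true.mp h
  refine List.any_eq_true.mpr ⟨r, hr, ?_⟩
  have hF : c.toState = r.1.toState := (toState_eq_iff c r.1).mpr hrc
  rw [← evalT_eq_iff_equivB, ← SData.toState_F, ← SData.toState_F, hF]

/-- A row passing `irowOK` passes `irowOKF`. [folklore] -/
theorem irowOKF_of_irowOK {q : ℕ} {rest : ICert K} {row : IRow K} (h : irowOK q rest row = true) :
    irowOKF q rest row = true := by
  unfold irowOK at h
  unfold irowOKF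
  rw [Bool.or_eq_true, Bool.or_eq_true] at h ⊢
  rcases h with (hb | ht) | hm
  · exact Or.inl (Or.inl hb)
  · exact Or.inl (Or.inr ht)
  · refine Or.inr ?_
    rw [Bool.and_eq_true, decide_eq_true_eq] at hm ⊢
    refine ⟨hm.1, fun j hj b hb => ?_⟩
    have h := hm.2 j hj b hb
    unfold ireplyOK at h
    unfold ireplyOKF
    rw [Bool.or_eq_true, Bool.or_eq_true] at h ⊢
    rcases h with (h1 | h2) | h3
    · exact Or.inl (Or.inl h1)
    · exact Or.inl (Or.inr h2)
    · exact Or.inr (ichildInF_of_ichildIn h3)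

/-- **Every `iwinCertBL` certificate is an `iwinCertBLF` certificate.** [folklore] -/
theorem iwinCertBLF_of_iwinCertBL {q : ℕ} (L : List (SData 4 K)) :
    ∀ {T : ICert K}, iwinCertBL q L T = true → iwinCertBLF q L T = true
  | [], _ => rfl
  | row :: rest, h => by
    unfold iwinCertBL at h
    unfold iwinCertBLF
    rw [Bool.and_eq_true] at h ⊢
    exact ⟨irowOKF_of_irowOK h.1, iwinCertBLF_of_iwinCertBL L h.2⟩

/-! ## 3. Acceptance over `𝔽₂`: the SCOPE-LOSS root against leaves with ERASED books -/

/-- p-14's four scope-loss leaves `x₁(x₂ + βx₃ + γx₄ + x₃x₄)` with their books `r = (1,0,0,0)`, `exc = {x₁}`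
ERASED to `r = 0`, `exc = ∅` (so only an F-keyed look-up can cite them). [folklore] -/
def scopeLossLeavesF : List (SData 4 (ZMod 2)) := scopeLossLeaves.map fun s => ⟨s.L, ![0, 0, 0, 0], ∅⟩

/-- The erased leaves are blind (their polynomials are those of the landed blind leaves). [folklore] -/
theorem leaves_scopeLossF : ∀ s ∈ scopeLossLeavesF, InScopeStateWins 2 s.toState := by
  intro s hs
  obtain ⟨t, ht, rfl⟩ := List.mem_map.mp hs
  exact FlatAbsorb.inScopeStateWins_congr (leaves_scopeLoss t ht) _ rfl

/-- The one-row root certificate passes the F-keyed check against the erased leaves (`decide`). -/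
theorem iwinCertBLF_scopeLossRootF : iwinCertBLF 2 scopeLossLeavesF scopeLossRootCert = true := by
  decide

end InScopeWinCert

end Summit.ResolutionOfSingularities.ResolutionOfSingularities.Theorems.PIDim4
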